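import Summits.Ventures.CertifiedManyBodySolver.Observables.PairLROTowerWitnessGroundState
import Summits.Ventures.CertifiedManyBodySolver.Observables.PairLROTowerChargedOpNorm
import Literature.MathematicalPhysics.QuantumLattice.DWaveSourceGSClassWindowCertificate
import Literature.MathematicalPhysics.QuantumLattice.DWaveSourceCanonicalClassChargedRows
import Literature.MathematicalPhysics.QuantumLattice.DWaveSourceEnergyDensityFenchelMoreau
import HarnessLib

/-!
# OP1-C in IDENTITY FORM, part 1: the charged `μ'`-cell one-point certificate read in the class of
# translation-invariant GROUND STATES of `H^{tt'} − μ_c N`, `|μ' − μ_c| ≤ Δ` (the obs / cq node conventions unified)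

HONEST FRAMING: soundness / bookkeeping theorems for a CEILING route at positivity scale; a ceiling never
speaks to the presence of pairing; not a superconductivity verdict; nothing in this file is a number. Crew
hubbard-obs (D-0042), seat hubbard-obs-p1 (`prover-hubbard-obs-p1-g11-0`), PAIRCORR-SDP §18.11 (a) / §19. Zero
compute; no definition; no named fact; no `sorry`.

The cell's OP1-C one-point certificates (registry row `OBS.PhiD1pt.tp0.TLB0gbTop1cB`, cover kit j266080) are typed
today as FINITE-TORUS orbit-state inequalities (`PairLROTowerChargedReadingTwistedFlipAux`) and read through the
Koma–Tasaki tower route. The SAME dual certificate is an IDENTITY in a window algebra `𝔄_{Λ'}` at the grid chemical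
potential `μ'` (`H' := pairSourceWindowHamiltonianTT' d Λ' t' U μ' 0 = H^{tt'}_{Λ'} − μ' N_{Λ'}`), the convention of the
hubbard-cq readers (`DWaveSourceTIClassWindowCertificate`, `DWaveSourceGSClassWindowCertificate`). This file reads that
identity in the class in which hubbard-obs-gs-2's ground-state-complete one-point reading
(`PairLROTowerWitnessGroundState`) lives — translation-invariant minimisers (= Bratteli–Kishimoto–Robinson ground
states) of `H^{tt'} − μ_c N` with the TRUE supporting slope `μ_c` somewhere in the cell `|μ' − μ_c| ≤ Δ`:

* (§0, tree) at zero pair field the Koma–Tasaki sourced interaction IS `hubbardTTPrimeMuInteraction`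
  (`hubbardTTPrimeSourcedInteraction_zero_source`, `…_zero_mu_zero_source`), so every sourced-class lemma of the cq
  files applies to the obs class at `h = 0`.
* §1 `re_expect_ge_of_cell_certificate_rows` — one state, every row explicit (unsourced cap `κ⁺` and floor `κ⁻`).
* §2 `re_sum_twistedFlipAct_expect_ge_of_chargedCell_certificate` — THE CELL READER: flip-twisted identity with a
  NEUTRAL `eom` block (number-conserving generators: exact at every chemical potential), a CHARGED `eom` block
  `Σᵢ ccᵢ • [H', Γ Wᵢ]` (real multipliers on ladder words `Wᵢ` of charge `qᵢ`; `[H', Γ W] = [H^{μ_c}, Γ W] − (μ' − μ_c) q Γ W`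
  costs `Δ |ccᵢ qᵢ| Bauxᵢ`, `Bauxᵢ` an auxiliary bound on the orbit mean `|(1/32) Σ_g Re (α_g ω)(Γ Wᵢ)|` read in the same
  class) and `kkt` CELLS `kktForm H' Gₑ B̃ₑ + skₑ • gramForm Gₑ B̃ₑ` on generator families of common charge `qkₑ`, sound
  whenever `skₑ ≥ Δ |qkₑ|` (graded KKT identity `kktForm (H − μ•N) G B = kktForm H G B − μ q • gramForm G B` +
  `Re ω(gram) ≥ 0`; `skₑ = 0` for neutral families) ⇒
  `c − Σ‖aₖ‖ + (Σμ)(ρ(ω)/2 − ν) − Δ Σᵢ |ccᵢ qᵢ| Bauxᵢ ≤ (1/32) Σ_g Re (α_g ω)(Xw)`.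
Part 2 (`PairLROGroundStateClassCover`) specialises to the pair objective and assembles a `μ`-cover into the registry
leaf through `ObsPairLROCeilingAt_of_groundState_onePoint_bound`. Same numbers as the torus route; what is NEW is that
ground-state POSITIVITY rows (`kkt`, neutral and charged-with-slack) become admissible on one-point `μ`-cell objects.

References: T. Koma, H. Tasaki, J. Stat. Phys. 76 (1994) 745, §1 [KomaTasaki1994]; O. Bratteli, A. Kishimoto,
D. W. Robinson, Commun. Math. Phys. 64 (1978) 41, Thm. 2 [BratteliKishimotoRobinson1978]; O. Bratteli, D. W. Robinson,
*OAQSM 2* (1997) Prop. 5.3.19, §5.2.2 [BratteliRobinsonII1997]; J. Wang et al., PRX 14 (2024) 031006, §III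
[WangEtAl2024]; M. Araújo et al., arXiv:2311.18707, §3.2 Prop. 11 [AraujoEtAl2023].
-/

noncomputable section

namespace Summit.Ventures.CertifiedManyBodySolver.Observables

open Matrix Complex Finset Literature.MathematicalPhysics.QuantumLattice Literature.Probability.LatticeModels
open Literature.MathematicalPhysics.QuantumLattice.HubbardWave0 ThermodynamicLimit Filter Topology
open Literature.MathematicalPhysics.QuantumManyBody.StateRelaxation
open Literature.MathematicalPhysics.QuantumLattice.InfVolFermionState (TwistFlipIndex twistedFlipAct
  twistedFlipAct_density)
open scoped ComplexOrder ComplexConjugate BigOperators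

/-! ### §1  One state, every row explicit: the unsourced energy rows (cap `κ⁺`, floor `κ⁻`) -/

section Cells

variable {ω : InfVolFermionState 2} {t' U : ℝ}

/-- **The one-point window certificate read in ONE abstract state, every row explicit** (the zero-field instance of
`re_expect_ge_of_sourced_certificate_TI_rows`). Identity in `𝔄_{Λ'}`:
`Xw − c·1 − Σ_σ μ_σ (n_{0σ} − ν·1) − κ⁺ (u·1 − Γ E^{tt'}) − κ⁻ (Γ E^{tt'} − ℓ·1)`
`  = Σ Λₐᵦ Oₐᴴ O_b + D + (Σₘ dₘ (Vₘᴴ − Vₘ) + Σₖ aₖ Wₖ)`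
(`Λm ⪰ 0`; `D` ARBITRARY — the block carrying the ground-state rows and the symmetry defects —; `dₘ` real; `Wₖ` ladder
words). Then for every state `ω`:
`c − Σ‖aₖ‖ + Σ_σ μ_σ (Re ω(n_{0σ}) − ν) + κ⁺ (u − e^{tt'}(ω)) + κ⁻ (e^{tt'}(ω) − ℓ) + Re ω(D) ≤ Re ω(Xw)`.
[cite: WangEtAl2024, §III] -/
theorem re_expect_ge_of_cell_certificate_rows (ω : InfVolFermionState 2) (t' U : ℝ)
    {Λ' : Finset (Site 2)} (h0 : thicken ({0} : Finset (Site 2)) 1 ⊆ Λ') (hz : (0 : Site 2) ∈ Λ')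
    (Xw D : FermionOp Λ') (κp κm u lo : ℝ) (μf : Fin 2 → ℝ) (ν : ℝ)
    {m : Type*} [Fintype m] [DecidableEq m] {Λm : Matrix m m ℂ} (hΛm : Λm.PosSemidef) (O : m → FermionOp Λ')
    {δ : Type*} (ah : Finset δ) (dc : δ → ℝ) (V : δ → FermionOp Λ')
    {κ'' : Type*} (w : Finset κ'') (a : κ'' → ℂ) (word : κ'' → List (Orb (PolySite Λ') × Bool)) {c : ℝ}
    (hcert : Xw - (c : ℂ) • (1 : FermionOp Λ') -
        ∑ σ : Fin 2, ((μf σ : ℝ) : ℂ) • (nAt 0 hz σ - ((ν : ℝ) : ℂ) • (1 : FermionOp Λ')) -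
        ((κp : ℝ) : ℂ) • (((u : ℝ) : ℂ) • (1 : FermionOp Λ') -
          fermionEmbed (PolySite.incl h0) ((hubbardTTPrimeFermionInteraction 1 t' U).meanEnergyObs 1)) -
        ((κm : ℝ) : ℂ) • (fermionEmbed (PolySite.incl h0) ((hubbardTTPrimeFermionInteraction 1 t' U).meanEnergyObs 1) -
          ((lo : ℝ) : ℂ) • (1 : FermionOp Λ')) =
      gramForm Λm O + D + (∑ m' ∈ ah, ((dc m' : ℝ) : ℂ) • ((V m')ᴴ - V m') + ∑ k ∈ w, a k • ladderWord (word k))) :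
    c - ∑ k ∈ w, ‖a k‖ + ∑ σ : Fin 2, μf σ * ((ω.expect Λ' (nAt 0 hz σ)).re - ν) +
        κp * (u - ω.meanEnergy (hubbardTTPrimeFermionInteraction 1 t' U) 1) +
        κm * (ω.meanEnergy (hubbardTTPrimeFermionInteraction 1 t' U) 1 - lo) + (ω.expect Λ' D).re ≤
      (ω.expect Λ' Xw).re := by
  have hS0 := hubbardTTPrimeSourcedInteraction_zero_mu_zero_source 1 t' U dWaveFormFactor
  have key := ω.re_expect_ge_of_sourced_certificate_TI_rows t' U 0 0 h0 hz Xw D κp κm u lo μf ν hΛm O ah dc V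
    w a word (by rw [hS0]; exact hcert)
  rw [hS0] at key
  exact key

/-! ### §2  The orbit form on the GROUND-STATE CLASS with a `μ'`-cell: charged `eom` slack and `kkt` cells -/

/-- The charge of an embedded ladder word: `N_{Λ'} Γ(W) − Γ(W) N_{Λ'} = q(W) • Γ(W)`, `q = ladderCharge`.
[cite: BratteliRobinsonII1997, §5.2.2] -/
theorem totalNumber_commutator_fermionEmbed_ladderWord {Λ Λ' : Finset (Site 2)} (hΛ : Λ ⊆ Λ')
    (l : List (Orb (PolySite Λ) × Bool)) :
    (totalNumber : FermionOp Λ') * fermionEmbed (PolySite.incl hΛ) (ladderWord l) -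
        fermionEmbed (PolySite.incl hΛ) (ladderWord l) * totalNumber =
      ((ladderCharge l : ℤ) : ℂ) • fermionEmbed (PolySite.incl hΛ) (ladderWord l) := by
  refine totalNumber_commutator_fermionEmbed_incl_of_commutator hΛ ?_
  rw [← totalNumberOp_eq_totalNumber]
  exact totalNumberOp_commutator_ladderWord l

/-- `H^{tt'}_{Λ'}(μ') = H^{tt'}_{Λ'}(μ_c) − (μ' − μ_c) • N_{Λ'}` for the zero-field window Hamiltonians.
[cite: KomaTasaki1994, §1] -/
theorem pairSourceWindowHamiltonianTT'_cell_shift (Λ' : Finset (Site 2)) (t' U μc μ' : ℝ) :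
    pairSourceWindowHamiltonianTT' dWaveFormFactor Λ' t' U μ' 0 =
      pairSourceWindowHamiltonianTT' dWaveFormFactor Λ' t' U μc 0 -
        (((μ' - μc : ℝ)) : ℂ) • (totalNumber : FermionOp Λ') := by
  rw [pairSourceWindowHamiltonianTT'_eq_zero_sub_smul_totalNumber dWaveFormFactor Λ' t' U μ' 0,
    pairSourceWindowHamiltonianTT'_eq_zero_sub_smul_totalNumber dWaveFormFactor Λ' t' U μc 0, Complex.ofReal_sub,
    sub_smul]
  abel

/-- **OP1-C IN IDENTITY FORM, read in every translation-invariant GROUND STATE of `H^{tt'} − μ_c N` with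
`|μ' − μ_c| ≤ Δ`** (the orbit form). The certificate is an identity in the window algebra `𝔄_{Λ'}` at the GRID
chemical potential `μ'` (`H' := pairSourceWindowHamiltonianTT' dWaveFormFactor Λ' t' U μ' 0 = H^{tt'}_{Λ'} − μ'N_{Λ'}`):
`Xw − c·1 − Σ_σ μ_σ (n_{0σ} − ν·1) − κ⁺ (u·1 − Γ E^{tt'}) − κ⁻ (Γ E^{tt'} − ℓ·1)
   = gramForm Λm O + (Σ_{k∈s} [H', B̃ₖ] + Σ_{i∈sc} ccᵢ • [H', Γ Wᵢ] + Σₗ bbₗ • (flip-twisted defect)ₗ)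
     + (Σₘ dₘ (Vₘᴴ − Vₘ) + Σₖ aₖ Wₖ) + Σ_{e∈kk} (kktForm H' Gₑ B̃kₑ + skₑ • gramForm Gₑ B̃kₑ)`
with: `Bₖ` NEUTRAL (`[N_Λ, Bₖ] = 0`: the number-conserving `eom` rows, valid at every chemical potential); `Wᵢ`
ladder words of charge `qᵢ` with REAL multipliers `ccᵢ` (the charged SLACK rows of the cell) and auxiliary bounds
`|(1/32) Σ_g Re (α_g ω)(Γ Wᵢ)| ≤ Bauxᵢ` (the auxiliary one-point certificates, read in the same class); `kkt` blocks on
generator families of common charge `qkₑ` with Gram slack `skₑ ≥ Δ·|qkₑ|` (`skₑ = 0` for neutral families); the cap row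
discharged on `ω` (`κ⁺ e^{tt'}(ω) ≤ κ⁺ u`) and the floor row on the translation-invariant states of density `ρ(ω)`.
CONCLUSION: `c − Σ‖aₖ‖ + (Σ_σ μ_σ)(ρ(ω)/2 − ν) − Δ · Σ_{i∈sc} |ccᵢ qᵢ| Bauxᵢ ≤ (1/32) Σ_g Re (α_g ω)_{Λ'}(Xw)`
for every translation-invariant minimiser `ω` of `H^{tt'} − μ_c N` (`= hubbardTTPrimeSourcedInteraction 1 t' U μ_c d 0`): each
`α_g ω` is again such a minimiser, hence a Bratteli–Kishimoto–Robinson ground state, in which `[H^{μ_c}, ·]` has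
expectation `0` and the `kkt` inequality holds; `[H', X] = [H^{μ_c}, X] − (μ' − μ_c) q(X) X` moves the grid point to `μ_c`
at the price `Δ|q|·|Re ω̄(X)|` (charged `eom`) resp. `Δ|q|·Re ω̄(gram) ≤ sk·Re ω̄(gram)` (charged `kkt`).
[cite: KomaTasaki1994, §1] [cite: BratteliKishimotoRobinson1978, Thm. 2 (p. 47)] [cite: WangEtAl2024, §III]
[cite: AraujoEtAl2023, §3.2 Prop. 11] -/
theorem re_sum_twistedFlipAct_expect_ge_of_chargedCell_certificate {μc μ' Δ : ℝ}
    (hmin : ω.IsMeanEnergyMinimiser (hubbardTTPrimeSourcedInteraction 1 t' U μc dWaveFormFactor 0) 1)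
    (hnear : |μ' - μc| ≤ Δ)
    {Λ Λ' : Finset (Site 2)} (hΛ : Λ ⊆ Λ') (h8 : thicken Λ 1 ⊆ Λ') (h0 : thicken ({0} : Finset (Site 2)) 1 ⊆ Λ')
    (hz : (0 : Site 2) ∈ Λ')
    (Xw : FermionOp Λ') (κp κm u lo : ℝ) (μf : Fin 2 → ℝ) (ν : ℝ)
    (hcap : κp * ω.meanEnergy (hubbardTTPrimeFermionInteraction 1 t' U) 1 ≤ κp * u)
    (hlo : ∀ σ : InfVolFermionState 2, σ.IsTranslationInvariant → σ.density = ω.density →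
      κm * lo ≤ κm * σ.meanEnergy (hubbardTTPrimeFermionInteraction 1 t' U) 1)
    {m : Type*} [Fintype m] [DecidableEq m] {Λm : Matrix m m ℂ} (hΛm : Λm.PosSemidef) (O : m → FermionOp Λ')
    {κ' : Type*} (s : Finset κ') (B : κ' → FermionOp Λ)
    (hB0 : ∀ k ∈ s, (totalNumber : FermionOp Λ) * B k - B k * totalNumber = 0)
    {κc : Type*} (sc : Finset κc) (cc Baux : κc → ℝ) (lc : κc → List (Orb (PolySite Λ) × Bool))
    (haux : ∀ i ∈ sc, |(∑ g : TwistFlipIndex,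
        ((ω.twistedFlipAct g).expect Λ' (fermionEmbed (PolySite.incl hΛ) (ladderWord (lc i)))).re) / 32| ≤ Baux i)
    {ι : Type*} (tt : Finset ι) (γ : ι → DihedralGroup 4) (wv : ι → Site 2) (fl mt : ι → Fin 2)
    (hsh : ∀ l, d4ShiftSet (γ l) (wv l) Λ ⊆ Λ') (bb : ι → ℂ) (yw : ι → List (Orb (PolySite Λ) × Bool))
    {δ : Type*} (ah : Finset δ) (dc : δ → ℝ) (V : δ → FermionOp Λ')
    {κ'' : Type*} (w : Finset κ'') (a : κ'' → ℂ) (word : κ'' → List (Orb (PolySite Λ') × Bool))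
    {ε : Type*} (kk : Finset ε) {β : Type*} [Fintype β] [DecidableEq β]
    (G : ε → Matrix β β ℂ) (hG : ∀ e ∈ kk, (G e).PosSemidef) (Bk : ε → β → FermionOp Λ) (qk sk : ε → ℝ)
    (hqk : ∀ e ∈ kk, ∀ b, (totalNumber : FermionOp Λ) * Bk e b - Bk e b * totalNumber = ((qk e : ℝ) : ℂ) • Bk e b)
    (hsk : ∀ e ∈ kk, Δ * |qk e| ≤ sk e) {c : ℝ}
    (hcert : Xw - (c : ℂ) • (1 : FermionOp Λ') -
        ∑ σ : Fin 2, ((μf σ : ℝ) : ℂ) • (nAt 0 hz σ - ((ν : ℝ) : ℂ) • (1 : FermionOp Λ')) -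
        ((κp : ℝ) : ℂ) • (((u : ℝ) : ℂ) • (1 : FermionOp Λ') -
          fermionEmbed (PolySite.incl h0) ((hubbardTTPrimeFermionInteraction 1 t' U).meanEnergyObs 1)) -
        ((κm : ℝ) : ℂ) • (fermionEmbed (PolySite.incl h0) ((hubbardTTPrimeFermionInteraction 1 t' U).meanEnergyObs 1) -
          ((lo : ℝ) : ℂ) • (1 : FermionOp Λ')) =
      gramForm Λm O +
        (∑ k ∈ s, (pairSourceWindowHamiltonianTT' dWaveFormFactor Λ' t' U μ' 0 * fermionEmbed (PolySite.incl hΛ) (B k) -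
            fermionEmbed (PolySite.incl hΛ) (B k) * pairSourceWindowHamiltonianTT' dWaveFormFactor Λ' t' U μ' 0) +
          ∑ i ∈ sc, ((cc i : ℝ) : ℂ) •
            (pairSourceWindowHamiltonianTT' dWaveFormFactor Λ' t' U μ' 0 *
                fermionEmbed (PolySite.incl hΛ) (ladderWord (lc i)) -
              fermionEmbed (PolySite.incl hΛ) (ladderWord (lc i)) *
                pairSourceWindowHamiltonianTT' dWaveFormFactor Λ' t' U μ' 0) +
          ∑ l ∈ tt, bb l • (gaugePhase (twistFlipExp (γ l) (fl l) (mt l)) (yw l) •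
              fermionEmbed (PolySite.incl (hsh l))
                (fermionEmbed (PolySite.d4Emb (γ l) (wv l) Λ) (spinSwapIter (fl l).val (ladderWord (yw l)))) -
            fermionEmbed (PolySite.incl hΛ) (ladderWord (yw l)))) +
        (∑ m' ∈ ah, ((dc m' : ℝ) : ℂ) • ((V m')ᴴ - V m') + ∑ k ∈ w, a k • ladderWord (word k)) +
        ∑ e ∈ kk, (kktForm (pairSourceWindowHamiltonianTT' dWaveFormFactor Λ' t' U μ' 0) (G e)
            (fun b => fermionEmbed (PolySite.incl hΛ) (Bk e b)) +
          ((sk e : ℝ) : ℂ) • gramForm (G e) (fun b => fermionEmbed (PolySite.incl hΛ) (Bk e b)))) :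
    c - ∑ k ∈ w, ‖a k‖ + (∑ σ : Fin 2, μf σ) * (ω.density / 2 - ν) -
        Δ * ∑ i ∈ sc, |cc i * (ladderCharge (lc i) : ℝ)| * Baux i ≤
      (∑ g : TwistFlipIndex, ((ω.twistedFlipAct g).expect Λ' Xw).re) / 32 := by
  -- names
  set Hp : FermionOp Λ' := pairSourceWindowHamiltonianTT' dWaveFormFactor Λ' t' U μ' 0 with hHp
  set Hc : FermionOp Λ' := pairSourceWindowHamiltonianTT' dWaveFormFactor Λ' t' U μc 0 with hHc
  have hshift : Hp = Hc - (((μ' - μc : ℝ)) : ℂ) • (totalNumber : FermionOp Λ') :=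
    pairSourceWindowHamiltonianTT'_cell_shift Λ' t' U μc μ'
  have hshift' : Hp - (((μc - μ' : ℝ)) : ℂ) • (totalNumber : FermionOp Λ') = Hc := by
    rw [hshift, Complex.ofReal_sub, Complex.ofReal_sub, sub_smul, sub_smul]
    abel
  set E : FermionOp Λ' := ∑ k ∈ s, (Hp * fermionEmbed (PolySite.incl hΛ) (B k) -
    fermionEmbed (PolySite.incl hΛ) (B k) * Hp) with hE
  set C : FermionOp Λ' := ∑ i ∈ sc, ((cc i : ℝ) : ℂ) • (Hp * fermionEmbed (PolySite.incl hΛ) (ladderWord (lc i)) -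
    fermionEmbed (PolySite.incl hΛ) (ladderWord (lc i)) * Hp) with hC
  set Df : FermionOp Λ' := ∑ l ∈ tt, bb l • (gaugePhase (twistFlipExp (γ l) (fl l) (mt l)) (yw l) •
      fermionEmbed (PolySite.incl (hsh l))
        (fermionEmbed (PolySite.d4Emb (γ l) (wv l) Λ) (spinSwapIter (fl l).val (ladderWord (yw l)))) -
    fermionEmbed (PolySite.incl hΛ) (ladderWord (yw l))) with hDf
  set K : FermionOp Λ' := ∑ e ∈ kk, (kktForm Hp (G e) (fun b => fermionEmbed (PolySite.incl hΛ) (Bk e b)) +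
    ((sk e : ℝ) : ℂ) • gramForm (G e) (fun b => fermionEmbed (PolySite.incl hΛ) (Bk e b))) with hK
  set D : FermionOp Λ' := (E + C + Df) + K with hD
  -- the identity with the ground-state blocks and defects in `D`
  have hcert' : Xw - (c : ℂ) • (1 : FermionOp Λ') -
        ∑ σ : Fin 2, ((μf σ : ℝ) : ℂ) • (nAt 0 hz σ - ((ν : ℝ) : ℂ) • (1 : FermionOp Λ')) -
        ((κp : ℝ) : ℂ) • (((u : ℝ) : ℂ) • (1 : FermionOp Λ') -
          fermionEmbed (PolySite.incl h0) ((hubbardTTPrimeFermionInteraction 1 t' U).meanEnergyObs 1)) -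
        ((κm : ℝ) : ℂ) • (fermionEmbed (PolySite.incl h0) ((hubbardTTPrimeFermionInteraction 1 t' U).meanEnergyObs 1) -
          ((lo : ℝ) : ℂ) • (1 : FermionOp Λ')) =
      gramForm Λm O + D + (∑ m' ∈ ah, ((dc m' : ℝ) : ℂ) • ((V m')ᴴ - V m') + ∑ k ∈ w, a k • ladderWord (word k)) := by
    rw [hcert, hD]
    abel
  -- each transform is again a minimiser; the one-state inequality there
  have hg : ∀ g : TwistFlipIndex,
      c - ∑ k ∈ w, ‖a k‖ + ∑ σ : Fin 2, μf σ * (((ω.twistedFlipAct g).expect Λ' (nAt 0 hz σ)).re - ν) +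
          κp * (u - (ω.twistedFlipAct g).meanEnergy (hubbardTTPrimeFermionInteraction 1 t' U) 1) +
          κm * ((ω.twistedFlipAct g).meanEnergy (hubbardTTPrimeFermionInteraction 1 t' U) 1 - lo) +
          ((ω.twistedFlipAct g).expect Λ' D).re ≤
        ((ω.twistedFlipAct g).expect Λ' Xw).re := fun g =>
    re_expect_ge_of_cell_certificate_rows (ω.twistedFlipAct g) t' U h0 hz Xw D κp κm u lo μf ν hΛm O ah dc V
      w a word hcert'
  -- (E) the neutral `eom` block vanishes in each transform
  have hEg : ∀ g : TwistFlipIndex, (ω.twistedFlipAct g).expect Λ' E = 0 := by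
    intro g
    have hming := hmin.twistedFlipAct g
    rw [hE, map_sum]
    refine Finset.sum_eq_zero fun k hk => ?_
    have hNB : (totalNumber : FermionOp Λ') * fermionEmbed (PolySite.incl hΛ) (B k) -
        fermionEmbed (PolySite.incl hΛ) (B k) * totalNumber = (0 : ℂ) • fermionEmbed (PolySite.incl hΛ) (B k) :=
      totalNumber_commutator_fermionEmbed_incl_of_commutator hΛ (by rw [hB0 k hk, zero_smul])
    have hcomm : Hp * fermionEmbed (PolySite.incl hΛ) (B k) - fermionEmbed (PolySite.incl hΛ) (B k) * Hp =
        Hc * fermionEmbed (PolySite.incl hΛ) (B k) - fermionEmbed (PolySite.incl hΛ) (B k) * Hc := by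
      rw [hshift, sub_smul_mul_sub_mul_sub_smul_of_commutator Hc totalNumber _ _ hNB, mul_zero, zero_smul, sub_zero]
    rw [hcomm, hHc]
    exact hming.expect_commutator_pairSourceWindowHamiltonianTT'_eq_zero hΛ h8 (B k)
  -- (C) the charged `eom` block: `Re ω_g(C) = −(μ' − μc) Σ_i cc_i q_i Re ω_g(Γ W_i)`
  have hCg : ∀ g : TwistFlipIndex, ((ω.twistedFlipAct g).expect Λ' C).re =
      -(μ' - μc) * ∑ i ∈ sc, cc i * (ladderCharge (lc i) : ℝ) *
        ((ω.twistedFlipAct g).expect Λ' (fermionEmbed (PolySite.incl hΛ) (ladderWord (lc i)))).re := by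
    intro g
    have hming := hmin.twistedFlipAct g
    rw [hC, map_sum, Complex.re_sum, Finset.mul_sum]
    refine Finset.sum_congr rfl fun i _ => ?_
    have hNW := totalNumber_commutator_fermionEmbed_ladderWord hΛ (lc i)
    have hcomm : Hp * fermionEmbed (PolySite.incl hΛ) (ladderWord (lc i)) -
        fermionEmbed (PolySite.incl hΛ) (ladderWord (lc i)) * Hp =
        (Hc * fermionEmbed (PolySite.incl hΛ) (ladderWord (lc i)) -
          fermionEmbed (PolySite.incl hΛ) (ladderWord (lc i)) * Hc) -
          ((((μ' - μc : ℝ)) : ℂ) * ((ladderCharge (lc i) : ℤ) : ℂ)) •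
            fermionEmbed (PolySite.incl hΛ) (ladderWord (lc i)) := by
      rw [hshift]
      exact sub_smul_mul_sub_mul_sub_smul_of_commutator Hc totalNumber _ _ hNW
    have h0c : (ω.twistedFlipAct g).expect Λ' (Hc * fermionEmbed (PolySite.incl hΛ) (ladderWord (lc i)) -
        fermionEmbed (PolySite.incl hΛ) (ladderWord (lc i)) * Hc) = 0 := by
      rw [hHc]
      exact hming.expect_commutator_pairSourceWindowHamiltonianTT'_eq_zero hΛ h8 (ladderWord (lc i))
    rw [map_smul, hcomm, map_sub, h0c, zero_sub, map_smul, smul_eq_mul, smul_eq_mul, Complex.re_ofReal_mul]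
    have e1 : ((((μ' - μc : ℝ)) : ℂ) * ((ladderCharge (lc i) : ℤ) : ℂ)) =
        (((μ' - μc) * (ladderCharge (lc i) : ℝ) : ℝ) : ℂ) := by push_cast; ring
    rw [e1, Complex.neg_re, Complex.re_ofReal_mul]
    ring
  -- (Df) the defects cancel in the orbit sum
  have hDfsum : ∑ g : TwistFlipIndex, ((ω.twistedFlipAct g).expect Λ' Df).re = 0 := by
    have h1 : ∑ g : TwistFlipIndex, (ω.twistedFlipAct g).expect Λ' Df = 0 := by
      simp only [hDf, map_sum, map_smul, smul_eq_mul]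
      rw [Finset.sum_comm]
      refine Finset.sum_eq_zero fun l _ => ?_
      rw [← Finset.mul_sum, hmin.1.sum_twistedFlipAct_expect_twistedFlipDefect_eq_zero hΛ (γ l) (wv l) (hsh l) (fl l)
        (mt l) (yw l), mul_zero]
    rw [← Complex.re_sum, h1, Complex.zero_re]
  -- (K) the `kkt` cells are nonnegative in each transform
  have hKg : ∀ g : TwistFlipIndex, 0 ≤ ((ω.twistedFlipAct g).expect Λ' K).re := by
    intro g
    have hming := hmin.twistedFlipAct g
    have hpos : ∀ A : FermionOp Λ', 0 ≤ (ω.twistedFlipAct g).expect Λ' (star A * A) := fun A => by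
      rw [Matrix.star_eq_conjTranspose]; exact (ω.twistedFlipAct g).expect_nonneg Λ' A
    rw [hK, map_sum, Complex.re_sum]
    refine Finset.sum_nonneg fun e he => ?_
    rw [map_add, Complex.add_re, map_smul, smul_eq_mul, Complex.re_ofReal_mul]
    -- the graded KKT inequality at the exact chemical potential `μc`: `(μ'−μc) q Re(gram) ≤ Re(kkt H')`
    have hgr := mul_re_map_gramForm_le_re_map_kktForm ((ω.twistedFlipAct g).expect Λ') Hp
      (totalNumber : FermionOp Λ') (μc - μ') (qk e) (hG e he) (fun b => fermionEmbed (PolySite.incl hΛ) (Bk e b))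
      (fun b => totalNumber_commutator_fermionEmbed_incl_of_commutator hΛ (hqk e he b)) (fun wt => by
        have hsum : ∑ j, wt j • fermionEmbed (PolySite.incl hΛ) (Bk e j) =
            fermionEmbed (PolySite.incl hΛ) (∑ j, wt j • Bk e j) := by
          rw [map_sum]
          exact Finset.sum_congr rfl fun j _ => (fermionEmbed_smul _ _ _).symm
        rw [hsum, Matrix.star_eq_conjTranspose, hshift', hHc]
        exact hming.re_expect_conj_commutator_pairSourceWindowHamiltonianTT'_nonneg hΛ h8 _)
    have hgram : 0 ≤ ((ω.twistedFlipAct g).expect Λ'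
        (gramForm (G e) (fun b => fermionEmbed (PolySite.incl hΛ) (Bk e b)))).re :=
      (Complex.nonneg_iff.1 (map_gramForm_nonneg ((ω.twistedFlipAct g).expect Λ') hpos (hG e he) _)).1
    have hbd : |(μc - μ') * qk e| ≤ sk e := by
      rw [abs_mul, abs_sub_comm]
      exact (mul_le_mul_of_nonneg_right hnear (abs_nonneg _)).trans (hsk e he)
    have hlow : -(sk e) ≤ (μc - μ') * qk e := (abs_le.1 hbd).1
    nlinarith [hgram, hgr, hlow]
  -- (N) the spin densities balance
  have hNsum : ∑ g : TwistFlipIndex, ∑ σ : Fin 2, μf σ * (((ω.twistedFlipAct g).expect Λ' (nAt 0 hz σ)).re - ν) =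
      32 * ((∑ σ : Fin 2, μf σ) * (ω.density / 2 - ν)) := by
    rw [Finset.sum_comm]
    have hσ : ∀ σ : Fin 2, ∑ g : TwistFlipIndex, μf σ * (((ω.twistedFlipAct g).expect Λ' (nAt 0 hz σ)).re - ν) =
        μf σ * (16 * ω.density - 32 * ν) := by
      intro σ
      rw [← Finset.mul_sum, Finset.sum_sub_distrib, ω.sum_twistedFlipAct_re_expect_nAt_zero hz σ, Finset.sum_const,
        Finset.card_univ, card_twistFlipIndex, nsmul_eq_mul, Nat.cast_ofNat]
    rw [Finset.sum_congr rfl fun σ _ => hσ σ, ← Finset.sum_mul]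
    ring
  -- the energy rows hold in every transform
  have hcapg : ∀ g : TwistFlipIndex,
      0 ≤ κp * (u - (ω.twistedFlipAct g).meanEnergy (hubbardTTPrimeFermionInteraction 1 t' U) 1) := by
    intro g
    rw [hmin.1.meanEnergy_hubbardTTPrime_twistedFlipAct, mul_sub]
    linarith
  have hlog : ∀ g : TwistFlipIndex,
      0 ≤ κm * ((ω.twistedFlipAct g).meanEnergy (hubbardTTPrimeFermionInteraction 1 t' U) 1 - lo) := by
    intro g
    have hl := hlo (ω.twistedFlipAct g) (hmin.1.twistedFlipAct g) (twistedFlipAct_density g ω)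
    rw [mul_sub]
    linarith
  -- the charged block in the orbit sum is bounded by the auxiliary nodes
  have hCsum : -(32 * (Δ * ∑ i ∈ sc, |cc i * (ladderCharge (lc i) : ℝ)| * Baux i)) ≤
      ∑ g : TwistFlipIndex, ((ω.twistedFlipAct g).expect Λ' C).re := by
    set S : κc → ℝ := fun i => ∑ g : TwistFlipIndex,
      ((ω.twistedFlipAct g).expect Λ' (fermionEmbed (PolySite.incl hΛ) (ladderWord (lc i)))).re with hS
    set X : ℝ := ∑ i ∈ sc, cc i * (ladderCharge (lc i) : ℝ) * S i with hX
    have step1 : ∑ g : TwistFlipIndex, ((ω.twistedFlipAct g).expect Λ' C).re = -(μ' - μc) * X := by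
      simp_rw [hCg]
      rw [← Finset.mul_sum, Finset.sum_comm]
      congr 1
      refine Finset.sum_congr rfl fun i _ => ?_
      rw [hS, Finset.mul_sum]
    have hSi : ∀ i ∈ sc, |S i| ≤ 32 * Baux i := by
      intro i hi
      have h := haux i hi
      rw [abs_div, abs_of_pos (by norm_num : (0 : ℝ) < 32), div_le_iff₀ (by norm_num : (0 : ℝ) < 32)] at h
      simpa only [hS, mul_comm] using h
    have step3 : |X| ≤ 32 * ∑ i ∈ sc, |cc i * (ladderCharge (lc i) : ℝ)| * Baux i := by
      rw [hX, Finset.mul_sum]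
      refine (Finset.abs_sum_le_sum_abs _ _).trans (Finset.sum_le_sum fun i hi => ?_)
      rw [abs_mul]
      have := mul_le_mul_of_nonneg_left (hSi i hi) (abs_nonneg (cc i * (ladderCharge (lc i) : ℝ)))
      linarith
    have hB : |(μ' - μc) * X| ≤ Δ * (32 * ∑ i ∈ sc, |cc i * (ladderCharge (lc i) : ℝ)| * Baux i) := by
      rw [abs_mul]
      exact mul_le_mul hnear step3 (abs_nonneg _) ((abs_nonneg _).trans hnear)
    have hle := le_abs_self ((μ' - μc) * X)
    rw [step1]
    linarith
  -- sum the one-state inequalities over the orbit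
  have hsum := Finset.sum_le_sum fun g (_ : g ∈ (Finset.univ : Finset TwistFlipIndex)) => hg g
  have hDg : ∀ g : TwistFlipIndex, ((ω.twistedFlipAct g).expect Λ' D).re =
      ((ω.twistedFlipAct g).expect Λ' C).re + ((ω.twistedFlipAct g).expect Λ' Df).re +
        ((ω.twistedFlipAct g).expect Λ' K).re := by
    intro g
    rw [hD, map_add, map_add, map_add, hEg g, zero_add, Complex.add_re, Complex.add_re]
  have hDsum : ∑ g : TwistFlipIndex, ((ω.twistedFlipAct g).expect Λ' D).re =
      ∑ g : TwistFlipIndex, ((ω.twistedFlipAct g).expect Λ' C).re +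
        ∑ g : TwistFlipIndex, ((ω.twistedFlipAct g).expect Λ' K).re := by
    rw [Finset.sum_congr rfl fun g (_ : g ∈ (Finset.univ : Finset TwistFlipIndex)) => hDg g,
      Finset.sum_add_distrib, Finset.sum_add_distrib, hDfsum, add_zero]
  have hKsum : 0 ≤ ∑ g : TwistFlipIndex, ((ω.twistedFlipAct g).expect Λ' K).re :=
    Finset.sum_nonneg fun g _ => hKg g
  rw [Finset.sum_add_distrib, Finset.sum_add_distrib, Finset.sum_add_distrib, Finset.sum_add_distrib, hDsum, hNsum,
    Finset.sum_const, Finset.card_univ, card_twistFlipIndex, nsmul_eq_mul, Nat.cast_ofNat] at hsum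
  have hp := Finset.sum_nonneg fun g (_ : g ∈ (Finset.univ : Finset TwistFlipIndex)) => hcapg g
  have hm := Finset.sum_nonneg fun g (_ : g ∈ (Finset.univ : Finset TwistFlipIndex)) => hlog g
  rw [le_div_iff₀ (by norm_num : (0 : ℝ) < 32)]
  linarith

end Cells

end Summit.Ventures.CertifiedManyBodySolver.Observables

end
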